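import Literature.AlgebraicGeometry.Resolution.Temkin2008Localization
import Literature.AlgebraicGeometry.Resolution.ExcellentRingsProofs
import HarnessLib

/-!
# Localizations of quasi-excellent rings are quasi-excellent (`Stacks07QU_localization_holds`)

Topic: `Literature/AlgebraicGeometry/Resolution`. Companion of `Temkin2008Localization.lean`
(proofs only, no new notions). DISCHARGES the named fact `Stacks07QU_localization` — the
localization clause of Stacks, Tag 07QU ("Any localization of a finite type ring over a
(quasi-)excellent ring is (quasi-)excellent"; Matsumura, *Commutative Ring Theory*, §32 p. 260:
the classes of G-rings / quasi-excellent / excellent rings "are closed under localisation,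
finitely generated extensions and passing to quotients") — one of the four leaves of the
decomposition `temkin2008_of_localization : Temkin2008_prop234 → Hironaka1964_local →
Stacks07QU → Stacks07QU_localization → Temkin2008` of Temkin's desingularization theorem
(`Temkin2008.lean`, `Temkin2008Localization.lean`).

`IsQuasiExcellentRing = IsGRing ∧ IsJ2Ring` (`ExcellentRings.lean`). The G-ring half under
localization is `isGRing_of_isLocalization` (`ExcellentRingsProofs.lean`, PROVED). This file
proves the J-2 half and assembles:

* `isLocalization_adjoin_of_adjoin_eq_top` — a finite type algebra `C = S⁻¹A[c₁, …, cₙ]` over a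
  localization `S⁻¹A` is the localization at (the image of) `S` of the finite type `A`-algebra
  `C₀ = A[c₁, …, cₙ] ⊆ C`.
* `mem_regularLocus_iff_comap_of_isLocalization`, `regularLocus_eq_preimage_comap_of_isLocalization`,
  `isOpen_regularLocus_of_isLocalization` — for a localization `R → T`, `Reg(T)` is the preimage
  of `Reg(R)` under `Spec T → Spec R` (the local rings agree: `T_𝔮 ≅ R_{𝔮 ∩ R}`), hence open
  when `Reg(R)` is.
* `isJ2Ring_of_isLocalization` — **a localization of a J-2 ring is J-2**;
  `IsJ2Ring.of_finiteType` — a finite type algebra over a J-2 ring is J-2 (transitivity of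
  finite type).
* `isQuasiExcellentRing_of_isLocalization`, `Stacks07QU_localization_holds` — the discharge.
* `isQuasiExcellentRing_stalk'`, `temkin2008_of_localization'` — the users in
  `Temkin2008Localization.lean` with the hypothesis `(h : Stacks07QU_localization)` fed:
  `Temkin2008_prop234 → Hironaka1964_local → Stacks07QU → Temkin2008`.

## Sources

* The Stacks Project, Tag 07QU (= Lemma 15.53.2: "Any localization of a finite type ring over
  a (quasi-)excellent ring is (quasi-)excellent. Proof. For finite type algebras this follows
  from the definitions for the properties J-2 and universally catenary. For G-rings, see
  Proposition 15.51.10 [= Tag 07PV]. We omit the proof that localization preserves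
  (quasi-)excellency."), Tag 07P7 (= Def. 15.48.1, J-2), Tag 07QT (= Def. 15.53.1,
  quasi-excellent = Noetherian + G-ring + J-2). The omitted localization argument is the
  elementary one written out above. [StacksProject]
* H. Matsumura, *Commutative Ring Theory*, CUP 1986, §32 p. 260 (the classes are "closed under
  localisation, finitely generated extensions and passing to quotients"). [Matsumura1987]
-/

noncomputable section

open CategoryTheory AlgebraicGeometry TopologicalSpace IsLocalRing

namespace Literature.AlgebraicGeometry.Resolution

universe u

/-! ## Finite type algebras over a localization are localizations of finite type algebras -/

section Adjoin

variable {A B C : Type u} [CommRing A] [CommRing B] [CommRing C] [Algebra A B] [Algebra B C]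
  [Algebra A C] [IsScalarTower A B C] (M : Submonoid A) [IsLocalization M B]

/-- **A finite type algebra over a localization is a localization of a finite type algebra.**
If `B = M⁻¹A` and `C = B[s]` is generated over `B` by a set `s`, then `C` is the localization of
the `A`-subalgebra `C₀ = A[s] ⊆ C` at the image of `M`: the elements of `M` become units in
`B`, hence in `C`; every element of `B[s]` is `c₀ / m` with `c₀ ∈ A[s]`, `m ∈ M` (induction on
`B[s]`); and `C₀ → C` is injective. [folklore] -/
theorem isLocalization_adjoin_of_adjoin_eq_top (s : Set C) (hs : Algebra.adjoin B s = ⊤) :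
    IsLocalization (Algebra.algebraMapSubmonoid (Algebra.adjoin A s) M) C where
  map_units := by
    rintro ⟨_, m, hm, rfl⟩
    change IsUnit (algebraMap (Algebra.adjoin A s) C (algebraMap A (Algebra.adjoin A s) m))
    rw [← IsScalarTower.algebraMap_apply, IsScalarTower.algebraMap_apply A B C]
    exact (IsLocalization.map_units B ⟨m, hm⟩).map (algebraMap B C)
  surj := by
    intro z
    have hz : z ∈ Algebra.adjoin B s := hs ▸ Algebra.mem_top
    refine Algebra.adjoin_induction (p := fun z _ =>
      ∃ x : Algebra.adjoin A s × Algebra.algebraMapSubmonoid (Algebra.adjoin A s) M,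
        z * algebraMap (Algebra.adjoin A s) C x.2 = algebraMap (Algebra.adjoin A s) C x.1)
      ?_ ?_ ?_ ?_ hz
    · intro x hx
      exact ⟨(⟨x, Algebra.subset_adjoin hx⟩, 1), by simp⟩
    · intro b
      obtain ⟨⟨a, m⟩, h⟩ := IsLocalization.surj M b
      refine ⟨(algebraMap A (Algebra.adjoin A s) a,
        ⟨algebraMap A (Algebra.adjoin A s) m, m, m.2, rfl⟩), ?_⟩
      change algebraMap B C b * algebraMap (Algebra.adjoin A s) C (algebraMap A _ (m : A)) =
        algebraMap (Algebra.adjoin A s) C (algebraMap A _ a)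
      rw [← IsScalarTower.algebraMap_apply, ← IsScalarTower.algebraMap_apply,
        IsScalarTower.algebraMap_apply A B C, IsScalarTower.algebraMap_apply A B C a, ← map_mul, h]
    · rintro x y - - ⟨⟨c₁, m₁⟩, h₁⟩ ⟨⟨c₂, m₂⟩, h₂⟩
      refine ⟨(c₁ * (m₂ : Algebra.adjoin A s) + c₂ * (m₁ : Algebra.adjoin A s), m₁ * m₂), ?_⟩
      simp only [Submonoid.coe_mul, map_mul, map_add] at h₁ h₂ ⊢
      linear_combination (algebraMap (Algebra.adjoin A s) C m₂) * h₁ +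
        (algebraMap (Algebra.adjoin A s) C m₁) * h₂
    · rintro x y - - ⟨⟨c₁, m₁⟩, h₁⟩ ⟨⟨c₂, m₂⟩, h₂⟩
      refine ⟨(c₁ * c₂, m₁ * m₂), ?_⟩
      simp only [Submonoid.coe_mul, map_mul] at h₁ h₂ ⊢
      linear_combination (y * algebraMap (Algebra.adjoin A s) C m₂) * h₁ +
        (algebraMap (Algebra.adjoin A s) C c₁) * h₂
  exists_of_eq := by
    intro x y hxy
    exact ⟨1, by simpa using Subtype.val_injective (by simpa using hxy)⟩

end Adjoin

/-! ## The regular locus of a localization -/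

section RegularLocus

variable {R T : Type u} [CommRing R] [CommRing T] [Algebra R T] (N : Submonoid R)
  [IsLocalization N T]

include N in
/-- For a localization `T = N⁻¹R` and a prime `𝔮` of `T`, `T_𝔮 ≅ R_{𝔮 ∩ R}`, so `𝔮` is a
regular point of `Spec T` iff `𝔮 ∩ R` is a regular point of `Spec R`. [folklore] -/
theorem mem_regularLocus_iff_comap_of_isLocalization (q : PrimeSpectrum T) :
    q ∈ regularLocus T ↔ PrimeSpectrum.comap (algebraMap R T) q ∈ regularLocus R := by
  haveI : IsScalarTower R T (Localization.AtPrime q.asIdeal) := IsScalarTower.of_algebraMap_eq' rfl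
  haveI : IsLocalization.AtPrime (Localization.AtPrime q.asIdeal)
      (q.asIdeal.comap (algebraMap R T)) :=
    IsLocalization.isLocalization_isLocalization_atPrime_isLocalization N
      (Localization.AtPrime q.asIdeal) q.asIdeal
  let e : Localization.AtPrime (q.asIdeal.comap (algebraMap R T)) ≃ₐ[R]
      Localization.AtPrime q.asIdeal :=
    IsLocalization.algEquiv (q.asIdeal.comap (algebraMap R T)).primeCompl _ _
  rw [mem_regularLocus, mem_regularLocus]
  change IsRegularLocalRing (Localization.AtPrime q.asIdeal) ↔
    IsRegularLocalRing (Localization.AtPrime (q.asIdeal.comap (algebraMap R T)))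
  exact ⟨fun _ => IsRegularLocalRing.of_ringEquiv e.toRingEquiv.symm,
    fun _ => IsRegularLocalRing.of_ringEquiv e.toRingEquiv⟩

include N in
/-- For a localization `T = N⁻¹R`, `Reg(T)` is the preimage of `Reg(R)` under
`Spec T → Spec R`. [folklore] -/
theorem regularLocus_eq_preimage_comap_of_isLocalization :
    regularLocus T = PrimeSpectrum.comap (algebraMap R T) ⁻¹' regularLocus R :=
  Set.ext fun q => mem_regularLocus_iff_comap_of_isLocalization N q

include N in
/-- For a localization `T = N⁻¹R`, if `Reg(R)` is open then so is `Reg(T)` (a preimage under the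
continuous map `Spec T → Spec R`). [folklore] -/
theorem isOpen_regularLocus_of_isLocalization (h : IsOpen (regularLocus R)) :
    IsOpen (regularLocus T) := by
  rw [regularLocus_eq_preimage_comap_of_isLocalization N]
  exact h.preimage (PrimeSpectrum.continuous_comap _)

end RegularLocus

/-! ## J-2 rings: localizations and finite type algebras -/

/-- **A localization of a J-2 ring is J-2** (Matsumura §32 p. 260; Stacks 07QU): `M⁻¹A` is
Noetherian, and a finite type `M⁻¹A`-algebra `C` is the localization at `M` of a finite type
`A`-algebra `C₀` (`isLocalization_adjoin_of_adjoin_eq_top`), so `Reg(C)` is the preimage of the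
open set `Reg(C₀)` under `Spec C → Spec C₀`.
[cite: Matsumura1987, §32 p. 260] -/
theorem isJ2Ring_of_isLocalization {A B : Type u} [CommRing A] [CommRing B] [Algebra A B]
    (M : Submonoid A) [IsLocalization M B] (hA : IsJ2Ring A) : IsJ2Ring B := by
  haveI : IsNoetherianRing A := hA.1
  refine ⟨IsLocalization.isNoetherianRing M B inferInstance, fun C _ _ hC => ?_⟩
  letI : Algebra A C := Algebra.compHom C (algebraMap A B)
  haveI : IsScalarTower A B C := IsScalarTower.of_algebraMap_eq fun _ => rfl
  obtain ⟨s, hs⟩ := hC.out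
  have hft : Algebra.FiniteType A (Algebra.adjoin A (s : Set C)) :=
    (Subalgebra.fg_iff_finiteType _).mp (Subalgebra.fg_adjoin_finset s)
  haveI := isLocalization_adjoin_of_adjoin_eq_top (A := A) (B := B) M (s : Set C) hs
  exact isOpen_regularLocus_of_isLocalization
    (Algebra.algebraMapSubmonoid (Algebra.adjoin A (s : Set C)) M)
    (hA.2 (Algebra.adjoin A (s : Set C)) hft)

/-- **A finite type algebra over a J-2 ring is J-2** (immediate from the definition: finite
type over finite type is finite type; Matsumura §32 p. 260). [cite: Matsumura1987, §32 p. 260] -/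
theorem IsJ2Ring.of_finiteType {A B : Type u} [CommRing A] [CommRing B] [Algebra A B]
    (hA : IsJ2Ring A) (hB : Algebra.FiniteType A B) : IsJ2Ring B := by
  haveI : IsNoetherianRing A := hA.1
  haveI : Algebra.FiniteType A B := hB
  refine ⟨Algebra.FiniteType.isNoetherianRing A B, fun C _ _ hC => ?_⟩
  letI : Algebra A C := Algebra.compHom C (algebraMap A B)
  haveI : IsScalarTower A B C := IsScalarTower.of_algebraMap_eq fun _ => rfl
  exact hA.2 C (hB.trans hC)

/-! ## Quasi-excellence: the discharge of `Stacks07QU_localization` -/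

/-- **A localization of a quasi-excellent ring is quasi-excellent** (Stacks 07QU; Matsumura
§32 p. 260): G-ring by `isGRing_of_isLocalization`, J-2 by `isJ2Ring_of_isLocalization`.
[cite: StacksProject, Tag 07QU] -/
theorem isQuasiExcellentRing_of_isLocalization {A B : Type u} [CommRing A] [CommRing B]
    [Algebra A B] (M : Submonoid A) [IsLocalization M B] (hA : IsQuasiExcellentRing A) :
    IsQuasiExcellentRing B :=
  ⟨isGRing_of_isLocalization M hA.isGRing, isJ2Ring_of_isLocalization M hA.isJ2Ring⟩

/-- DISCHARGE of the named fact `Stacks07QU_localization` (`Temkin2008Localization.lean`):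
localizations of quasi-excellent rings are quasi-excellent. [cite: StacksProject, Tag 07QU] -/
theorem Stacks07QU_localization_holds : Stacks07QU_localization.{u} :=
  fun _A _B _ _ _ M hM hA => @isQuasiExcellentRing_of_isLocalization _ _ _ _ _ M hM hA

/-- Under `Stacks07QU`, the J-2 half being unconditional: a finite type algebra over a
quasi-excellent ring is J-2. [cite: Matsumura1987, §32 p. 260] -/
theorem IsQuasiExcellentRing.isJ2Ring_of_finiteType {A B : Type u} [CommRing A] [CommRing B]
    [Algebra A B] (hA : IsQuasiExcellentRing A) (hB : Algebra.FiniteType A B) : IsJ2Ring B :=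
  hA.isJ2Ring.of_finiteType hB

/-! ## Consequences for the decomposition of `Temkin2008` -/

/-- Stalks of a scheme locally of finite type over a quasi-excellent scheme are quasi-excellent,
now under `Stacks07QU` alone (`isQuasiExcellentRing_stalk` with `Stacks07QU_localization_holds`).
[cite: StacksProject, Tag 07QU] -/
theorem isQuasiExcellentRing_stalk' (h07 : Stacks07QU.{u}) {X k : Scheme.{u}} (f : X ⟶ k)
    [LocallyOfFiniteType f] (hk : Scheme.IsQuasiExcellent k) (x : X) :
    IsQuasiExcellentRing (X.presheaf.stalk x) :=
  isQuasiExcellentRing_stalk h07 Stacks07QU_localization_holds f hk x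

/-- **Temkin 2008, Thm. 2.3.6 (`Z = ∅`), weak form = `Temkin2008`, from three named facts**:
`temkin2008_of_localization` with its fourth hypothesis `Stacks07QU_localization` discharged.
[cite: Temkin2008, Thm. 2.3.6 and Prop. 2.3.4] -/
theorem temkin2008_of_localization' (hP : Temkin2008_prop234.{u}) (hH : Hironaka1964_local.{u})
    (h07 : Stacks07QU.{u}) : Temkin2008.{u} :=
  temkin2008_of_localization hP hH h07 Stacks07QU_localization_holds

end Literature.AlgebraicGeometry.Resolution

end
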